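import Literature.NumberTheory.EllipticCurves.ProfiniteGroupDistributionTwisting
import HarnessLib

/-!
# Translate–scale bookkeeping for bounded distributions: `μ′ := c • δ_{τ,0} μ` (level data, bound, integral)

Topic `NumberTheory/EllipticCurves`; namespace `Literature.NumberTheory.EllipticCurves.GroupDistribution`.  Cell `bsd-print-cf2`,
width seat `bsd-line-cf2-p1-w5` g17, piece T-1 of the `j = 0` seam (assigned by the packager -w3 g31): the measure handed to the
supply statement is the measure of record TRANSLATED by a Galois element `τ` (the reading conjugacy of the `p`-adic / complex
readings, `…KatzMeasureJZeroReadingConjugacy`) and SCALED by a constant `c` (the period unit over `12`).  In the tree's currency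
(`twisting τ 0 μ = δ_τ * μ` is LEFT translation, `ProfiniteGroupDistributionTwisting`; `smul c`, `ProfiniteGroupDistributionRing`)
this file records, for ANY normed field `𝕜` (non-archimedean, complete where integrals occur) and any tower of normal subgroups:

* `twisting_zero_μ` / `smul_twisting_zero_μ` — level data `μ′_n(b) = c · μ_n(τ̄⁻¹ b)`;
* `twisting_zero_bound'` / `smul_twisting_zero_bound` — recorded bounds `‖μ‖` and `‖c‖·‖μ‖` (so `≤ 1` iff `‖c‖·‖μ‖ ≤ 1`,
  `smul_twisting_zero_bound_le_one`); `norm_smul_twisting_zero_μ_le` — the level data are bounded by `‖c‖·r` whenever those of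
  `μ` are bounded by `r` (the form in which a 4-divisible measure of record is fed);
* ★ `integral_twisting_zero'` / `integral_smul_twisting_zero` — `∫ f dμ′ = c · ∫ f(τ·x) dμ(x)` for tower-continuous `f`, and
  ★ `integral_smul_twisting_zero_of_map_mul` — **`∫ f dμ′ = c · f(τ) · ∫ f dμ`** for `f` with `f(τx) = f(τ)f(x)` (DIRECTION: the
  factor is `f τ`, not `f τ⁻¹`, because `twisting` translates on the LEFT by `τ`); the order `twisting τ 0 (smul c μ)` gives the
  same level data and integral (`twisting_zero_smul_μ`, `integral_twisting_zero_smul_of_map_mul`).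
* Tower-continuity of the test function is a property of `f` and the tower alone — unchanged under either operation (nothing to prove).

HONEST FRAMING: three-line consequences of `twisting_μ`, `integral_twisting`, `integral_smul`; no elliptic curves, no BSD.

## References
* [deShalit1987] E. de Shalit, *Iwasawa theory of elliptic curves with complex multiplication* (1987), I.3.1 (p. 15–16),
  II.4.12 (p. 66–68) (`δ_𝔞`, `μ(𝔣) = μ_𝔞/(12 δ_𝔞)`).
-/

noncomputable section

open Filter Topology

namespace Literature.NumberTheory.EllipticCurves.GroupDistribution

variable {G : Type*} [Group G] {𝒰 : SubgroupTower G} {𝕜 : Type*} [NormedField 𝕜] [IsUltrametricDist 𝕜]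
variable [∀ n, (𝒰.U n).Normal]

/-! ### §1. Level data and bounds -/

/-- Level data of the translate: `(δ_{τ,0} μ)_n (b) = μ_n (τ̄⁻¹ b)`. [cite: deShalit1987, II.4.12 (p. 67–68)] -/
theorem twisting_zero_μ (τ : G) (D : GroupDistribution 𝒰 𝕜) (n : ℕ) (b : G ⧸ 𝒰.U n) :
    (twisting τ 0 D).μ n b = D.μ n ((𝒰.proj n τ)⁻¹ * b) := by
  rw [twisting_μ, zero_mul, sub_zero]

/-- Level data of the scaled translate: `(c • δ_{τ,0} μ)_n (b) = c · μ_n (τ̄⁻¹ b)`. [cite: deShalit1987, II.4.12 (p. 67–68)] -/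
theorem smul_twisting_zero_μ (c : 𝕜) (τ : G) (D : GroupDistribution 𝒰 𝕜) (n : ℕ) (b : G ⧸ 𝒰.U n) :
    (smul c (twisting τ 0 D)).μ n b = c * D.μ n ((𝒰.proj n τ)⁻¹ * b) := by
  rw [smul_μ, twisting_zero_μ]

/-- The two orders agree on level data: `(δ_{τ,0} (c • μ))_n = (c • δ_{τ,0} μ)_n`. [cite: deShalit1987, II.4.12 (p. 67–68)] -/
theorem twisting_zero_smul_μ (c : 𝕜) (τ : G) (D : GroupDistribution 𝒰 𝕜) (n : ℕ) (b : G ⧸ 𝒰.U n) :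
    (twisting τ 0 (smul c D)).μ n b = (smul c (twisting τ 0 D)).μ n b := by
  rw [twisting_zero_μ, smul_μ, smul_twisting_zero_μ]

/-- The recorded bound of the translate is that of `μ`. [cite: deShalit1987, II.4.12 (p. 67)] -/
theorem twisting_zero_bound' (τ : G) (D : GroupDistribution 𝒰 𝕜) : (twisting τ 0 D).bound = D.bound := by
  rw [twisting_bound, norm_zero, max_eq_left zero_le_one, one_mul]

/-- The recorded bound of the scaled translate is `‖c‖ · ‖μ‖`. [cite: deShalit1987, I.3.1 (p. 15–16)] -/
theorem smul_twisting_zero_bound (c : 𝕜) (τ : G) (D : GroupDistribution 𝒰 𝕜) :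
    (smul c (twisting τ 0 D)).bound = ‖c‖ * D.bound := by
  rw [smul_bound, twisting_zero_bound']

/-- `‖c‖ · ‖μ‖ ≤ 1 ⟹` the scaled translate is recorded as integral (`bound ≤ 1`). [cite: deShalit1987, I.3.1 (p. 15–16)] -/
theorem smul_twisting_zero_bound_le_one {c : 𝕜} (τ : G) {D : GroupDistribution 𝒰 𝕜} (h : ‖c‖ * D.bound ≤ 1) :
    (smul c (twisting τ 0 D)).bound ≤ 1 := by
  rw [smul_twisting_zero_bound]; exact h

/-- Level-wise bound transfer: if the level data of `μ` are bounded by `r`, those of `c • δ_{τ,0} μ` are bounded by `‖c‖ · r`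
(e.g. `r = ‖4‖`, `‖c‖ = ‖4‖⁻¹`). [cite: deShalit1987, II.4.12 (p. 69)] -/
theorem norm_smul_twisting_zero_μ_le (c : 𝕜) (τ : G) (D : GroupDistribution 𝒰 𝕜) {r : ℝ}
    (hr : ∀ (n : ℕ) (b : G ⧸ 𝒰.U n), ‖D.μ n b‖ ≤ r) (n : ℕ) (b : G ⧸ 𝒰.U n) :
    ‖(smul c (twisting τ 0 D)).μ n b‖ ≤ ‖c‖ * r := by
  rw [smul_twisting_zero_μ, norm_mul]
  exact mul_le_mul_of_nonneg_left (hr _ _) (norm_nonneg c)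

/-! ### §2. Integrals -/

variable [CompleteSpace 𝕜]

/-- **`∫ f d(δ_{τ,0}μ) = ∫ f(τ·x) dμ(x)`** (left translation; generic-field form of `KatzMeasureTranslate.integral_twisting_zero`).
[cite: deShalit1987, II.4.12 (p. 66–68)] -/
theorem integral_twisting_zero' (τ : G) (D : GroupDistribution 𝒰 𝕜) {f : G → 𝕜} (hf : 𝒰.IsTowerContinuous f) :
    (twisting τ 0 D).integral f = D.integral (fun x ↦ f (τ * x)) := by
  rw [integral_twisting τ 0 D hf, zero_mul, sub_zero]

/-- ★ **`∫ f d(c • δ_{τ,0}μ) = c · ∫ f(τ·x) dμ(x)`** for tower-continuous `f`. [cite: deShalit1987, II.4.12 (p. 66–68)] -/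
theorem integral_smul_twisting_zero (c : 𝕜) (τ : G) (D : GroupDistribution 𝒰 𝕜) {f : G → 𝕜}
    (hf : 𝒰.IsTowerContinuous f) :
    (smul c (twisting τ 0 D)).integral f = c * D.integral (fun x ↦ f (τ * x)) := by
  rw [integral_smul c _ hf, integral_twisting_zero' τ D hf]

/-- ★ **Multiplicative test functions: `∫ f d(c • δ_{τ,0}μ) = c · f(τ) · ∫ f dμ`** for `f` tower-continuous with
`f (τ * x) = f τ * f x` (a character). The factor is `f τ` (LEFT translation by `τ`); to obtain `f τ⁻¹` translate by `τ⁻¹`.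
[cite: deShalit1987, II.4.12 (p. 67–68), II.4.14 Step 1 (29)↔(31) (p. 71)] -/
theorem integral_smul_twisting_zero_of_map_mul (c : 𝕜) (τ : G) (D : GroupDistribution 𝒰 𝕜) {f : G → 𝕜}
    (hf : 𝒰.IsTowerContinuous f) (hmul : ∀ x, f (τ * x) = f τ * f x) :
    (smul c (twisting τ 0 D)).integral f = c * f τ * D.integral f := by
  rw [integral_smul_twisting_zero c τ D hf, mul_assoc, ← D.integral_const_mul (f τ) hf]
  congr 1
  exact D.integral_congr fun x ↦ hmul x

/-- The translate alone: `∫ f d(δ_{τ,0}μ) = f(τ) · ∫ f dμ` for multiplicative tower-continuous `f`.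
[cite: deShalit1987, II.4.14 Step 1 (29)↔(31) (p. 71)] -/
theorem integral_twisting_zero_of_map_mul' (τ : G) (D : GroupDistribution 𝒰 𝕜) {f : G → 𝕜}
    (hf : 𝒰.IsTowerContinuous f) (hmul : ∀ x, f (τ * x) = f τ * f x) :
    (twisting τ 0 D).integral f = f τ * D.integral f := by
  rw [integral_twisting_zero' τ D hf, ← D.integral_const_mul (f τ) hf]
  exact D.integral_congr fun x ↦ hmul x

/-- The other order: `∫ f d(δ_{τ,0}(c • μ)) = c · f(τ) · ∫ f dμ`. [cite: deShalit1987, II.4.12 (p. 67–68)] -/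
theorem integral_twisting_zero_smul_of_map_mul (c : 𝕜) (τ : G) (D : GroupDistribution 𝒰 𝕜) {f : G → 𝕜}
    (hf : 𝒰.IsTowerContinuous f) (hmul : ∀ x, f (τ * x) = f τ * f x) :
    (twisting τ 0 (smul c D)).integral f = c * f τ * D.integral f := by
  rw [integral_twisting_zero_of_map_mul' τ _ hf hmul, integral_smul c D hf]
  ring

/-- **The `12 · I′` bookkeeping of the seam**: if `d · c = e` (e.g. `12 · (ε_ϑ/12) = ε_ϑ`) then for a multiplicative
tower-continuous `f`, `d · ∫ f d(c • δ_{τ,0}μ) = e · f(τ) · ∫ f dμ` — the hypothesis `hI : 12 · I′ = Θ(ε_ϑ) · ∫ f dμ` of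
`twist_mul_eq_of_perUnit_normalised` for `I′ := ∫ f dμ′`, up to the translation factor `f τ`. [cite: deShalit1987, II.4.12 (p. 69)] -/
theorem mul_integral_smul_twisting_zero_of_map_mul {c d e : 𝕜} (hdc : d * c = e) (τ : G) (D : GroupDistribution 𝒰 𝕜)
    {f : G → 𝕜} (hf : 𝒰.IsTowerContinuous f) (hmul : ∀ x, f (τ * x) = f τ * f x) :
    d * (smul c (twisting τ 0 D)).integral f = e * f τ * D.integral f := by
  rw [integral_smul_twisting_zero_of_map_mul c τ D hf hmul, ← hdc]
  ring

end Literature.NumberTheory.EllipticCurves.GroupDistribution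

end
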